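import Literature.AnabelianGeometry.AbsoluteAnabelian.ArchimedeanReconstructionGroupLawProofs
import Literature.Geometry.Kaehler.ComplexTorus
import Mathlib.GroupTheory.CoprodI
import Mathlib.GroupTheory.OrderOfElement
import Mathlib.Data.ZMod.Basic
import HarnessLib

/-!
# [AbsTopIII] Corollary 2.7 (a)(b)(c)(e): holomorphic elliptic cuspidalization — SUB-DAG statements

S. Mochizuki, *Topics in absolute anabelian geometry III*, §2, Corollary 2.7 "Local Linear
Holomorphic Structures via Holomorphic Elliptic Cuspidalization", kurims manuscript pp. 58–60 (bib key
`MochizukiAbsTopIII2015`; lit key `paper:url-5493eb38cbb7`; journal pagination not held).  Cell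
sub-DAG (D-0068 (1), L4 SUBDAG-WANTED v1 2026-08-26) of the node AbsTopIII:Cor2.7, items (a)(b)(c)(e)
(item (d), `OneParameterSubgroupsPSL2R`, is a separate row), seat abc-iut-L4-t12; table
`plan/L4/SUBDAG-AbsTopIII-Cor-27.md`.

The printed proof (p. 60) reads, verbatim: "The validity of the algorithm asserted in Corollary 2.7
is immediate from the constructions that appear in the statement of this algorithm [together with the
references quoted in these constructions]."  The typed statement of record is
`ArchimedeanReconstruction.lean` (p408225): (a) `IsEllipticallyAdmissiblePresentation` (predicate),
(b) `EllipticCuspidalizationDiagram`, `cuspidalTorsionPoints` (definitions), (c) the named fact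
`TorsionPointsDenseUniqueGroupLaw` (density ∧ uniqueness), (e) `linHolStructureOfCharted`; the
proof-only companion `ArchimedeanReconstructionGroupLawProofs.lean` (p409175, seat abc-iut-L6-t21)
PROVED the uniqueness half and `torsionPointsDenseUniqueGroupLaw_iff_dense` (the fact reduces to its
density clause).  What remains of (b)/(c) is the CONSTRUCTION the statement quotes — "By considering
'elliptic cuspidalization diagrams' as in [Mzk21], Example 3.2" (p. 59; [Mzk21] = [AbsTopII], whose
Example 3.2 (i) p. 66 is the multiplication-by-`N` diagram `D ↩ U → D`, "`[N]_D : U → D` [of degree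
`N²`], together with an open embedding `U ↪ D`", of a once-punctured elliptic curve `D`) — and "Since the
torsion points of (b) are dense in `E^top`" (p. 59).  This file types that construction AT THE MODEL (the tree's complex tori
`Literature.Geometry.Kaehler.ComplexTorus Φ`, `Φ : ℝ^ι ≃ ℂ` a period isomorphism, seat-independent
library) and cuts the remaining proof into named sub-node STATEMENTS (`def … : Prop`, no proofs), plus
the kernel-checked COMPOSITIONS showing that the sub-nodes assemble:

* §1 the model: `puncturedTorus Φ` (`𝔼 = T ∖ {0}`), `nsmulLocus Φ N` (`𝕌_N = T ∖ T[N]`),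
  `nsmulCov Φ N` (`[N] : 𝕌_N → 𝔼`), `nsmulImm Φ N` (`𝕌_N ↪ 𝔼`);
* §2 sub-nodes (b) at the model, one per field of `EllipticCuspidalizationDiagram`:
  `NsmulCovIsFiniteEtale`, `NsmulCovIsMorphism`, `NsmulDeckAbelianTransitive` (+ the sharp form
  `NsmulDeckGroup`: `Gal(𝕌_N/𝔼) ≅ T[N]` by translations — "the group structure on these torsion points
  [which is induced by the group structure of the Galois group `Gal(U/E)`]"), `NsmulImmIsMorphism`,
  `NsmulImmComplement`, `NsmulCoholomorphic`; COMPOSITION `nsmulDiagram` (the `[N]`-diagram IS an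
  `EllipticCuspidalizationDiagram`) and `mem_cuspidalTorsionPoints_of_nsmul_eq_zero` (every non-zero
  `N`-torsion point is a cuspidal torsion point); the converse inclusion `CuspidalTorsionPointsAreTorsion`
  ("the torsion points … as the points in the complement of the image of such morphisms") with its
  topological core `AbelianCoverOfPuncturedTorusExtends` ("[which necessarily extends to a covering of
  the one-point compactification of `E^top`]");
* §3 sub-nodes (c): `TorsionPointsDense` (torsion of a complex torus is dense), `CuspidalTorsionPointsDenseModel`
  (PROVED here from §2 + `TorsionPointsDense`: `cuspidalTorsionPointsDenseModel_of_subnodes`),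
  `GenusOneUniformization` (classical INPUT, Farkas–Kra IV.6.1 (c): a compact Riemann surface
  homeomorphic to a torus is a complex torus `ℂ/Λ` — the only non-elementary external input),
  `PuncturedEllipticCurveModel` (a punctured elliptic curve in the sense of
  `TorsionPointsDenseUniqueGroupLaw.IsPuncturedEllipticCurve` is biholomorphic to some `puncturedTorus Φ`),
  `CuspidalTorsionPointsTransport` (biholomorphisms carry cuspidal torsion points to cuspidal torsion
  points), `OnePointPuncturedTorus` ("[the one-point compactification of] `E^top`" is `T`); COMPOSITIONS
  `dense_cuspidalTorsionPoints_of_subnodes` and **`torsionPointsDenseUniqueGroupLaw_of_subnodes`**: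
  the named fact `TorsionPointsDenseUniqueGroupLaw` follows from the sub-nodes (kernel-checked);
* §4 sub-node (a): `IndexTwoTorsionFreeUnique` — "the unique torsion-free subgroup of index two of the
  group `Π`" ([Mzk21] = [AbsTopII] Remark 3.1.1): the free product of three groups of order two has
  exactly one torsion-free subgroup of index two.

Items (c) second half and (e) ("local additive structures", line segments, parallelograms, frames,
orientations, `𝒜_p`) are compositions with Prop 2.5/2.6, typed in `HolomorphicCores.lean` (p407343)
and instantiated at the model in `HolomorphicCoresLocalLinearProofs.lean` (p412533); they are indexed
in the table, not re-typed here.  No statement of the paper is strengthened; every sub-node is either a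
special case at the model of a printed clause or a classical input named with its source.
HONEST FRAMING: OUR typing of the steps of a statement of a refereed paper; typed ≠ proved; nothing here
bears on the disputed [IUTchIII] Cor. 3.12.
-/

noncomputable section

namespace Literature.AnabelianGeometry.AbsoluteAnabelian

open _root_.TopologicalSpace _root_.Topology _root_.Filter
open scoped _root_.Manifold _root_.ContDiff
open Literature.Geometry.Kaehler (ComplexTorus)

namespace HolomorphicEllipticCuspidalization

/-! ### §1 The model: the `[N]`-diagrams of a one-dimensional complex torus -/

section Model

variable {ι : Type} [Fintype ι] (Φ : (ι → ℝ) ≃L[ℝ] ℂ)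

/-- The **once-punctured complex torus** `𝔼 = T ∖ {0}`, `T = ℂ/Φ(ℤ^ι)`, as an open subset of the
complex torus (hence a Riemann surface, `TopologicalSpace.Opens.instChartedSpace`): the model of "the
Aut-holomorphic space associated to a once-punctured elliptic curve" of Cor 2.7 (a).
[cite: MochizukiAbsTopIII2015, Corollary 2.7 (a) pp.58–59] -/
def puncturedTorus : Opens (ComplexTorus Φ) := ⟨{0}ᶜ, isOpen_compl_singleton⟩

/-- Membership in the punctured torus: `x ∈ 𝔼 ↔ x ≠ 0`. [cite: MochizukiAbsTopIII2015, Corollary 2.7 (a) pp.58–59] -/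
@[simp] theorem mem_puncturedTorus_iff (x : ComplexTorus Φ) : x ∈ puncturedTorus Φ ↔ x ≠ 0 := Iff.rfl

/-- The open subset `𝕌_N = T ∖ T[N] = [N]⁻¹(𝔼)` of the torus: the total space of the `N`-th elliptic
cuspidalization diagram ([Mzk21] = [AbsTopII], Example 3.2 (i) p.66: "the morphism `[N]_E : E → E` given
by multiplication by `N` determines a finite étale covering `[N]_D : U → D` [of degree `N²`], together
with an open embedding `U ↪ D`"; here `D = 𝔼`, `U = 𝕌_N`).
[cite: MochizukiAbsTopIII2015, Corollary 2.7 (b) p.59] -/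
def nsmulLocus (N : ℕ) : Opens (ComplexTorus Φ) :=
  ⟨(fun x : ComplexTorus Φ => N • x) ⁻¹' (puncturedTorus Φ : Set (ComplexTorus Φ)),
    (puncturedTorus Φ).isOpen.preimage (continuous_nsmul N)⟩

/-- Membership in `𝕌_N`: `x ∈ 𝕌_N ↔ N • x ≠ 0`. [cite: MochizukiAbsTopIII2015, Corollary 2.7 (b) p.59] -/
@[simp] theorem mem_nsmulLocus_iff (N : ℕ) (x : ComplexTorus Φ) : x ∈ nsmulLocus Φ N ↔ N • x ≠ 0 :=
  Iff.rfl

/-- The **covering** `[N] : 𝕌_N → 𝔼`, `x ↦ N • x` ("`U → E` is an abelian finite étale covering").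
[cite: MochizukiAbsTopIII2015, Corollary 2.7 (b) p.59] -/
def nsmulCov (N : ℕ) : nsmulLocus Φ N → puncturedTorus Φ := fun x => ⟨N • (x : ComplexTorus Φ), x.2⟩

/-- `[N]` on `𝕌_N` is multiplication by `N`. [cite: MochizukiAbsTopIII2015, Corollary 2.7 (b) p.59] -/
@[simp] theorem coe_nsmulCov (N : ℕ) (x : nsmulLocus Φ N) :
    ((nsmulCov Φ N x : puncturedTorus Φ) : ComplexTorus Φ) = N • (x : ComplexTorus Φ) := rfl

/-- The **open immersion** `𝕌_N ↪ 𝔼` ("`E^top ↩ U^top` is an open immersion whose image is the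
complement of a finite subset of `E^top`"): the inclusion (`N • x ≠ 0` forces `x ≠ 0`).
[cite: MochizukiAbsTopIII2015, Corollary 2.7 (b) p.59] -/
def nsmulImm (N : ℕ) : nsmulLocus Φ N → puncturedTorus Φ := fun x =>
  ⟨x, fun h => x.2 (by
    have hx : (x : ComplexTorus Φ) = 0 := h
    show N • (x : ComplexTorus Φ) ∈ ({0} : Set (ComplexTorus Φ))
    rw [hx, smul_zero]
    rfl)⟩

/-- The open immersion is the inclusion on points. [cite: MochizukiAbsTopIII2015, Corollary 2.7 (b) p.59] -/
@[simp] theorem coe_nsmulImm (N : ℕ) (x : nsmulLocus Φ N) :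
    ((nsmulImm Φ N x : puncturedTorus Φ) : ComplexTorus Φ) = (x : ComplexTorus Φ) := rfl

/-- The open immersion `𝕌_N ↪ 𝔼` is injective. [cite: MochizukiAbsTopIII2015, Corollary 2.7 (b) p.59] -/
theorem nsmulImm_injective (N : ℕ) : Function.Injective (nsmulImm Φ N) := by
  intro x y h
  have h' := congrArg (fun z : puncturedTorus Φ => (z : ComplexTorus Φ)) h
  exact Subtype.ext h'

end Model

/-! ### §2 Sub-nodes of (b): the `[N]`-diagram is an elliptic cuspidalization diagram -/

section ItemB

/-- **Sub-node (b).1**: `[N] : 𝕌_N → 𝔼` is finite étale — a covering map with finite fibres ("`U → E`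
is an abelian finite étale covering"; at the model: multiplication by `N ≠ 0` on `T = (ℝ/ℤ)^ι` is a
covering map with fibres of cardinality `N^{|ι|}`, restricted to the preimage `𝕌_N` of the open `𝔼`).
[cite: MochizukiAbsTopIII2015, Corollary 2.7 (b) p.59] -/
def NsmulCovIsFiniteEtale : Prop :=
  ∀ (ι : Type) [Fintype ι] (Φ : (ι → ℝ) ≃L[ℝ] ℂ) (N : ℕ), N ≠ 0 → IsFiniteEtale (nsmulCov Φ N)

/-- **Sub-node (b).2**: `[N] : 𝕌_N → 𝔼` is a morphism of the associated Aut-holomorphic spaces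
(Def 2.1 (ii): a local homeomorphism transporting `Aut^hol` of connected opens; at the model: `[N]` is a
holomorphic local biholomorphism of Riemann surfaces, cf. the tree's
`ComplexTorus.mdifferentiable_mapMatrix_smul_one`). [cite: MochizukiAbsTopIII2015, Corollary 2.7 (b) p.59] -/
def NsmulCovIsMorphism : Prop :=
  ∀ (ι : Type) [Fintype ι] (Φ : (ι → ℝ) ≃L[ℝ] ℂ) (N : ℕ), N ≠ 0 →
    IsMorphism (AutHolStructure.ofCharted ↥(nsmulLocus Φ N))
      (AutHolStructure.ofCharted ↥(puncturedTorus Φ)) (nsmulCov Φ N)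

/-- **Sub-node (b).3** ("abelian"): the deck transformation group `Gal(𝕌_N/𝔼)` of `[N]` is
commutative and acts transitively on the fibres — the field `cov_galois_abelian` of
`EllipticCuspidalizationDiagram`, verbatim, at the model. [cite: MochizukiAbsTopIII2015, Corollary 2.7 (b) p.59] -/
def NsmulDeckAbelianTransitive : Prop :=
  ∀ (ι : Type) [Fintype ι] (Φ : (ι → ℝ) ≃L[ℝ] ℂ) (N : ℕ), N ≠ 0 →
    (∀ φ ψ : deckGroup (nsmulCov Φ N), φ * ψ = ψ * φ) ∧
      ∀ u u' : nsmulLocus Φ N, nsmulCov Φ N u = nsmulCov Φ N u' →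
        ∃ φ : deckGroup (nsmulCov Φ N), (φ : nsmulLocus Φ N ≃ₜ nsmulLocus Φ N) u = u'

/-- **Sub-node (b).3♯** (the sharp form of (b).3, and the content of "the group structure on these
torsion points [which is induced by the group structure of the Galois group `Gal(U/E)`]"): every deck
transformation of `[N] : 𝕌_N → 𝔼` is the restriction of the translation by a unique `N`-torsion point,
and this is a group isomorphism `Gal(𝕌_N/𝔼) ≅ T[N]` (cf. the tree's
`ComplexTorus.IsIsogeny.mem_deckTransformations_iff` for the unrestricted isogeny `[N] : T → T`).
[cite: MochizukiAbsTopIII2015, Corollary 2.7 (b) p.59] -/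
def NsmulDeckGroup : Prop :=
  ∀ (ι : Type) [Fintype ι] (Φ : (ι → ℝ) ≃L[ℝ] ℂ) (N : ℕ), N ≠ 0 →
    ∃ e : deckGroup (nsmulCov Φ N) ≃*
        Multiplicative ((nsmulAddMonoidHom N : ComplexTorus Φ →+ ComplexTorus Φ).ker),
      ∀ (φ : deckGroup (nsmulCov Φ N)) (u : nsmulLocus Φ N),
        (((φ : nsmulLocus Φ N ≃ₜ nsmulLocus Φ N) u : nsmulLocus Φ N) : ComplexTorus Φ) =
          (u : ComplexTorus Φ) + ((Multiplicative.toAdd (e φ) : (nsmulAddMonoidHom N :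
            ComplexTorus Φ →+ ComplexTorus Φ).ker) : ComplexTorus Φ)

/-- **Sub-node (b).4**: the inclusion `𝕌_N ↪ 𝔼` is an open immersion and a morphism of the associated
Aut-holomorphic spaces ("`E ↩ U` … co-holomorphic" morphisms; at the model: the inclusion of an open
Riemann subsurface). [cite: MochizukiAbsTopIII2015, Corollary 2.7 (b) p.59] -/
def NsmulImmIsMorphism : Prop :=
  ∀ (ι : Type) [Fintype ι] (Φ : (ι → ℝ) ≃L[ℝ] ℂ) (N : ℕ), N ≠ 0 →
    IsOpenEmbedding (nsmulImm Φ N) ∧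
      IsMorphism (AutHolStructure.ofCharted ↥(nsmulLocus Φ N))
        (AutHolStructure.ofCharted ↥(puncturedTorus Φ)) (nsmulImm Φ N)

/-- **Sub-node (b).5**: the image of `𝕌_N ↪ 𝔼` is "the complement of a finite subset of `E^top`",
namely of the non-zero `N`-torsion points: `x ∈ 𝔼 ∖ 𝕌_N ↔ N • x = 0` (finiteness: `T[N]` has
`N^{|ι|}` elements, cf. the tree's `ComplexTorus.natCard_ker_mapMatrixHom_sublatticePeriod`).
[cite: MochizukiAbsTopIII2015, Corollary 2.7 (b) p.59] -/
def NsmulImmComplement : Prop :=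
  ∀ (ι : Type) [Fintype ι] (Φ : (ι → ℝ) ≃L[ℝ] ℂ) (N : ℕ), N ≠ 0 →
    (Set.range (nsmulImm Φ N))ᶜ.Finite ∧
      ∀ x : puncturedTorus Φ, x ∈ (Set.range (nsmulImm Φ N))ᶜ ↔ N • (x : ComplexTorus Φ) = 0

/-- **Sub-node (b).6**: "`E ↩ U`, `U → E` are co-holomorphic" — in the Riemann-surface form
`IsCoHolomorphicRS` of Cor 2.3 (i) used by `EllipticCuspidalizationDiagram`: at points of one connected
component, `[N]` and the inclusion land in one component of `𝔼` and are holomorphic together (at the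
model both are holomorphic everywhere and `𝔼` is connected). [cite: MochizukiAbsTopIII2015, Corollary 2.7 (b) p.59] -/
def NsmulCoholomorphic : Prop :=
  ∀ (ι : Type) [Fintype ι] (Φ : (ι → ℝ) ≃L[ℝ] ℂ) (N : ℕ), N ≠ 0 →
    IsCoHolomorphicRS (nsmulCov Φ N) (nsmulImm Φ N)

/-- **COMPOSITION (b)**: granted the sub-nodes (b).1–(b).6, the `[N]`-diagram `𝔼 ↩ 𝕌_N → 𝔼` of the
model punctured torus IS an elliptic cuspidalization diagram in the typed sense
(`EllipticCuspidalizationDiagram`, every field supplied by the corresponding sub-node) — the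
construction "as in [Mzk21], Example 3.2" quoted in (b). [cite: MochizukiAbsTopIII2015, Corollary 2.7 (b) p.59] -/
def nsmulDiagram (h₁ : NsmulCovIsFiniteEtale) (h₂ : NsmulCovIsMorphism)
    (h₃ : NsmulDeckAbelianTransitive) (h₄ : NsmulImmIsMorphism) (h₅ : NsmulImmComplement)
    (h₆ : NsmulCoholomorphic) {ι : Type} [Fintype ι] (Φ : (ι → ℝ) ≃L[ℝ] ℂ) (N : ℕ) (hN : N ≠ 0) :
    EllipticCuspidalizationDiagram ↥(puncturedTorus Φ) where
  U := ↥(nsmulLocus Φ N)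
  cov := nsmulCov Φ N
  imm := nsmulImm Φ N
  cov_finiteEtale := h₁ ι Φ N hN
  cov_morphism := h₂ ι Φ N hN
  cov_galois_abelian := h₃ ι Φ N hN
  imm_openEmbedding := (h₄ ι Φ N hN).1
  imm_morphism := (h₄ ι Φ N hN).2
  imm_cofinite := (h₅ ι Φ N hN).1
  coholomorphic := h₆ ι Φ N hN

/-- **COMPOSITION (b)**, "one may construct the torsion points of [the elliptic curve determined by]
`E` as the points in the complement of the image of such morphisms `U ↪ E`", inclusion `⊇` at the
model: granted the sub-nodes (b).1–(b).6, every non-zero `N`-torsion point (`N ≠ 0`) of the torus is a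
cuspidal torsion point of `𝔼` (witnessed by the `[N]`-diagram `nsmulDiagram`).
[cite: MochizukiAbsTopIII2015, Corollary 2.7 (b) p.59] -/
theorem mem_cuspidalTorsionPoints_of_nsmul_eq_zero (h₁ : NsmulCovIsFiniteEtale)
    (h₂ : NsmulCovIsMorphism) (h₃ : NsmulDeckAbelianTransitive) (h₄ : NsmulImmIsMorphism)
    (h₅ : NsmulImmComplement) (h₆ : NsmulCoholomorphic) {ι : Type} [Fintype ι]
    (Φ : (ι → ℝ) ≃L[ℝ] ℂ) {N : ℕ} (hN : N ≠ 0) (x : puncturedTorus Φ)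
    (hx : N • (x : ComplexTorus Φ) = 0) : x ∈ cuspidalTorsionPoints ↥(puncturedTorus Φ) :=
  ⟨nsmulDiagram h₁ h₂ h₃ h₄ h₅ h₆ Φ N hN, ((h₅ ι Φ N hN).2 x).2 hx⟩

/-- **Sub-node (b).7**, the topological core of "an abelian finite étale covering [which necessarily
extends to a covering of the one-point compactification of `E^top`]": a finite étale covering
`q : Y → 𝔼` of the punctured torus whose deck group is commutative and transitive on fibres extends
to a covering `q̄ : Ȳ → T` of the (unpunctured) torus, `Y ⊆ Ȳ` being the preimage of `𝔼` (the loop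
around the puncture is a commutator in `π₁(𝔼)`, free of rank two, hence has trivial monodromy in any
abelian Galois covering). [cite: MochizukiAbsTopIII2015, Corollary 2.7 (b) p.59] -/
def AbelianCoverOfPuncturedTorusExtends : Prop :=
  ∀ (ι : Type) [Fintype ι] (Φ : (ι → ℝ) ≃L[ℝ] ℂ) (Y : Type) [TopologicalSpace Y]
    (q : Y → puncturedTorus Φ), IsFiniteEtale q →
    (∀ φ ψ : deckGroup q, φ * ψ = ψ * φ) →
    (∀ y y' : Y, q y = q y' → ∃ φ : deckGroup q, (φ : Y ≃ₜ Y) y = y') →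
    ∃ (Yc : Type) (_ : TopologicalSpace Yc) (qc : Yc → ComplexTorus Φ) (j : Y → Yc),
      IsCoveringMap qc ∧ (∀ t, (qc ⁻¹' {t}).Finite) ∧ IsOpenEmbedding j ∧
        (∀ y, qc (j y) = (q y : ComplexTorus Φ)) ∧
        Set.range j = qc ⁻¹' (puncturedTorus Φ : Set (ComplexTorus Φ))

/-- **Sub-node (b).8**, inclusion `⊆` of "the torsion points … as the points in the complement of the
image of such morphisms `U ↪ E`", at the model: every cuspidal torsion point of `𝔼 = T ∖ {0}` (a point
off the image of SOME elliptic cuspidalization diagram `𝔼 ↩ 𝕌 → 𝔼`, in the typed sense) is a torsion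
point of the torus `T`.  Printed justification: the covering extends over the puncture ((b).7), the
open immersion extends to an isomorphism of the compactifications (Riemann), and an unramified
(RC-)holomorphic self-map of `T` fixing `0` is a homomorphism (the tree's
`ComplexTorus.map_add_of_mdifferentiable`), whose kernel is finite; the holomorphy of both maps enters
through Cor 2.3 (i) (`LocalMorphismIsRCHolomorphic`) and their co-holomorphicity.
[cite: MochizukiAbsTopIII2015, Corollary 2.7 (b) p.59] -/
def CuspidalTorsionPointsAreTorsion : Prop :=
  ∀ (ι : Type) [Fintype ι] (Φ : (ι → ℝ) ≃L[ℝ] ℂ) (x : puncturedTorus Φ),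
    x ∈ cuspidalTorsionPoints ↥(puncturedTorus Φ) → IsOfFinAddOrder (x : ComplexTorus Φ)

end ItemB

/-! ### §3 Sub-nodes of (c): density of the torsion points and the group law -/

section ItemC

/-- **Sub-node (c).1** ("the torsion points of (b) are dense in `E^top`", first half, at the model):
the torsion points of a complex torus `T = ℂ/Φ(ℤ^ι)` — as a topological group `(ℝ/ℤ)^ι` — are dense
(they contain `(ℚ/ℤ)^ι`). [cite: MochizukiAbsTopIII2015, Corollary 2.7 (c) p.59] -/
def TorsionPointsDense : Prop :=
  ∀ (ι : Type) [Fintype ι] (Φ : (ι → ℝ) ≃L[ℝ] ℂ), Dense {x : ComplexTorus Φ | IsOfFinAddOrder x}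

/-- **Sub-node (c).2** ("the torsion points of (b) are dense in `E^top`", at the model): the cuspidal
torsion points of the punctured torus `𝔼 = T ∖ {0}` are dense in `𝔼`.  PROVED below from (b).1–(b).6 and
(c).1 (`cuspidalTorsionPointsDenseModel_of_subnodes`). [cite: MochizukiAbsTopIII2015, Corollary 2.7 (c) p.59] -/
def CuspidalTorsionPointsDenseModel : Prop :=
  ∀ (ι : Type) [Fintype ι] (Φ : (ι → ℝ) ≃L[ℝ] ℂ), Dense (cuspidalTorsionPoints ↥(puncturedTorus Φ))

/-- The torsion points of `T` that lie in the open `𝔼 = T ∖ {0}` are dense in `𝔼` when the torsion points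
are dense in `T` (elementary topology: a dense set meets every non-empty open subset of an open
subspace). [cite: MochizukiAbsTopIII2015, Corollary 2.7 (c) p.59] -/
theorem dense_torsion_puncturedTorus {ι : Type} [Fintype ι] (Φ : (ι → ℝ) ≃L[ℝ] ℂ)
    (hd : Dense {x : ComplexTorus Φ | IsOfFinAddOrder x}) :
    Dense {x : puncturedTorus Φ | IsOfFinAddOrder (x : ComplexTorus Φ)} := by
  rw [dense_iff_inter_open]
  intro V hV hne
  -- the image of `V` in `T` is open and non-empty, hence meets the torsion points
  have hVo : IsOpen (((↑) : puncturedTorus Φ → ComplexTorus Φ) '' V) :=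
    (puncturedTorus Φ).isOpen.isOpenMap_subtype_val V hV
  obtain ⟨v, hv⟩ := hne
  obtain ⟨t, ⟨w, hwV, rfl⟩, ht⟩ :=
    dense_iff_inter_open.1 hd _ hVo ⟨(v : ComplexTorus Φ), ⟨v, hv, rfl⟩⟩
  exact ⟨w, hwV, ht⟩

/-- **COMPOSITION (c)**: the sub-nodes (b).1–(b).6 (the `[N]`-diagrams are elliptic cuspidalization
diagrams) and (c).1 (torsion is dense in `T`) give (c).2: the cuspidal torsion points of the model
punctured torus are dense ("Since the torsion points of (b) are dense in `E^top`", p. 59).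
[cite: MochizukiAbsTopIII2015, Corollary 2.7 (c) p.59] -/
theorem cuspidalTorsionPointsDenseModel_of_subnodes (h₁ : NsmulCovIsFiniteEtale)
    (h₂ : NsmulCovIsMorphism) (h₃ : NsmulDeckAbelianTransitive) (h₄ : NsmulImmIsMorphism)
    (h₅ : NsmulImmComplement) (h₆ : NsmulCoholomorphic) (hd : TorsionPointsDense) :
    CuspidalTorsionPointsDenseModel := by
  intro ι _ Φ
  refine (dense_torsion_puncturedTorus Φ (hd ι Φ)).mono ?_
  intro x hx
  -- `x ≠ 0` is a torsion point of order `N = addOrderOf x ≠ 0`: use the `[N]`-diagram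
  have hN : addOrderOf (x : ComplexTorus Φ) ≠ 0 := (addOrderOf_pos_iff.2 hx).ne'
  exact mem_cuspidalTorsionPoints_of_nsmul_eq_zero h₁ h₂ h₃ h₄ h₅ h₆ Φ hN x
    (addOrderOf_nsmul_eq_zero (x : ComplexTorus Φ))

/-- **Sub-node (c).3 — classical INPUT, the uniformization theorem for tori** (Farkas–Kra, *Riemann
Surfaces*, Thm IV.6.1 (c): "The only surfaces with `π₁(M) ≅ ℤ ⊕ ℤ` … are the tori `ℂ/G`, where `G` is
generated by `z ↦ z + 1` and `z ↦ z + τ`, Im `τ > 0`"; ibid. III.6.4 Cor. 1, the Abel–Jacobi map of a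
genus-one surface is an isomorphism): a compact connected Riemann surface homeomorphic to a torus is
biholomorphic to a one-dimensional complex torus `ℂ/Φ(ℤ²)` of the tree.  Cor 2.7 uses it silently in
"[the elliptic curve determined by] `E`" / "is the Aut-holomorphic space associated to a once-punctured
elliptic curve": the typed hypothesis `IsPuncturedEllipticCurve` is conformal-topological.  Stated as
the consequence needed (any period isomorphism `Φ`, not the normalised `(τ, 1)`).
[cite: FarkasKra1992, §IV.6.1 Theorem (c); §III.6.4 Corollary 1] -/
def GenusOneUniformization : Prop :=
  ∀ (T : Type) [TopologicalSpace T] [T2Space T] [CompactSpace T] [ConnectedSpace T]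
    [ChartedSpace ℂ T] [IsManifold 𝓘(ℂ, ℂ) ω T],
    Nonempty (T ≃ₜ AddCircle (1 : ℝ) × AddCircle (1 : ℝ)) →
    ∃ (Φ : (Fin 2 → ℝ) ≃L[ℝ] ℂ) (e : T ≃ₜ ComplexTorus Φ),
      MDifferentiable 𝓘(ℂ, ℂ) 𝓘(ℂ, ℂ) e ∧ MDifferentiable 𝓘(ℂ, ℂ) 𝓘(ℂ, ℂ) e.symm

/-- **Sub-node (c).4**: a punctured elliptic curve in the typed (conformal) sense
`TorsionPointsDenseUniqueGroupLaw.IsPuncturedEllipticCurve` — biholomorphic to `T ∖ {t₀}`, `T` a compact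
connected Riemann surface homeomorphic to a torus — is biholomorphic to the model punctured torus
`𝔼 = ℂ/Φ(ℤ²) ∖ {0}` for some period isomorphism `Φ` ((c).3 followed by a translation moving `t₀` to `0`
and restriction to the complements; "[the elliptic curve determined by] `E`").
[cite: MochizukiAbsTopIII2015, Corollary 2.7 (c) p.59] -/
def PuncturedEllipticCurveModel : Prop :=
  ∀ (E : Type) [TopologicalSpace E] [T2Space E] [ChartedSpace ℂ E] [IsManifold 𝓘(ℂ, ℂ) ω E],
    TorsionPointsDenseUniqueGroupLaw.IsPuncturedEllipticCurve E →
    ∃ (Φ : (Fin 2 → ℝ) ≃L[ℝ] ℂ) (e : E ≃ₜ ↥(puncturedTorus Φ)),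
      MDifferentiable 𝓘(ℂ, ℂ) 𝓘(ℂ, ℂ) e ∧ MDifferentiable 𝓘(ℂ, ℂ) 𝓘(ℂ, ℂ) e.symm

/-- **Sub-node (c).5** (transport): a biholomorphism of Riemann surfaces `e : E ⥲ E'` carries the
cuspidal torsion points of `E` onto those of `E'` (it transports elliptic cuspidalization diagrams:
composition of the two morphisms `𝕌 → 𝔼` with the isomorphism of Aut-holomorphic spaces induced by
`e`; "functoriality" of the algorithm in the tautological case of an isomorphism).
[cite: MochizukiAbsTopIII2015, Corollary 2.7 (b) p.59] -/
def CuspidalTorsionPointsTransport : Prop :=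
  ∀ (E E' : Type) [TopologicalSpace E] [T2Space E] [ChartedSpace ℂ E] [IsManifold 𝓘(ℂ, ℂ) ω E]
    [TopologicalSpace E'] [T2Space E'] [ChartedSpace ℂ E'] [IsManifold 𝓘(ℂ, ℂ) ω E'] (e : E ≃ₜ E'),
    MDifferentiable 𝓘(ℂ, ℂ) 𝓘(ℂ, ℂ) e → MDifferentiable 𝓘(ℂ, ℂ) 𝓘(ℂ, ℂ) e.symm →
      e '' cuspidalTorsionPoints E = cuspidalTorsionPoints E'

/-- **COMPOSITION (c), density**: the sub-nodes (c).4 (model of a punctured elliptic curve), (c).5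
(transport) and (c).2 (density at the model) give the density clause of Cor 2.7 (c) for every punctured
elliptic curve in the typed sense: "the torsion points of (b) are dense in `E^top`".
[cite: MochizukiAbsTopIII2015, Corollary 2.7 (c) p.59] -/
theorem dense_cuspidalTorsionPoints_of_subnodes (h₁ : PuncturedEllipticCurveModel)
    (h₂ : CuspidalTorsionPointsTransport) (h₃ : CuspidalTorsionPointsDenseModel)
    (E : Type) [TopologicalSpace E] [T2Space E] [ChartedSpace ℂ E] [IsManifold 𝓘(ℂ, ℂ) ω E]
    (hE : TorsionPointsDenseUniqueGroupLaw.IsPuncturedEllipticCurve E) :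
    Dense (cuspidalTorsionPoints E) := by
  obtain ⟨Φ, e, he, he'⟩ := h₁ E hE
  have himage : e '' cuspidalTorsionPoints E = cuspidalTorsionPoints ↥(puncturedTorus Φ) :=
    h₂ E ↥(puncturedTorus Φ) e he he'
  have hpre : cuspidalTorsionPoints E = e.symm '' cuspidalTorsionPoints ↥(puncturedTorus Φ) := by
    rw [← himage, ← Set.image_comp]
    simp
  rw [hpre, dense_iff_closure_eq, ← e.symm.image_closure, (h₃ (Fin 2) Φ).closure_eq,
    Set.image_univ, e.symm.range_coe]

/-- **COMPOSITION (c), the named fact**: the sub-nodes (c).4, (c).5, (c).2 give the typed Cor 2.7 (c)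
`TorsionPointsDenseUniqueGroupLaw` (density ∧ uniqueness of the extending topological group law), via
the reduction `torsionPointsDenseUniqueGroupLaw_iff_dense` (uniqueness PROVED, p409175).  With
`cuspidalTorsionPointsDenseModel_of_subnodes`, (c).2 is in turn (b).1–(b).6 ∧ (c).1; and (c).4 is
(c).3 (Farkas–Kra IV.6.1 (c)) plus translation/restriction.
[cite: MochizukiAbsTopIII2015, Corollary 2.7 (c) p.59] -/
theorem torsionPointsDenseUniqueGroupLaw_of_subnodes (h₁ : PuncturedEllipticCurveModel)
    (h₂ : CuspidalTorsionPointsTransport) (h₃ : CuspidalTorsionPointsDenseModel) :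
    Literature.AnabelianGeometry.AbsoluteAnabelian.TorsionPointsDenseUniqueGroupLaw :=
  torsionPointsDenseUniqueGroupLaw_iff_dense.2 fun E _ _ _ _ hE =>
    dense_cuspidalTorsionPoints_of_subnodes h₁ h₂ h₃ E hE

/-- **Sub-node (c).6** ("[the one-point compactification of] `E^top`"): the one-point compactification
of the punctured torus `𝔼 = T ∖ {0}` is the torus — the inclusion extends to a homeomorphism
`OnePoint 𝔼 ≃ₜ T` sending `∞` to `0`.  Along it the group law of `T` is "the group structure on [the
one-point compactification of] `E^top` [that arises from the elliptic curve determined by `E`]", which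
by (b).3♯ extends "the group structure on the torsion points of (b)" and by the PROVED uniqueness half
(`torsionPoints_groupLaw_unique`) is the unique such topological group structure.
[cite: MochizukiAbsTopIII2015, Corollary 2.7 (c) p.59] -/
def OnePointPuncturedTorus : Prop :=
  ∀ (ι : Type) [Fintype ι] (Φ : (ι → ℝ) ≃L[ℝ] ℂ),
    ∃ e : OnePoint ↥(puncturedTorus Φ) ≃ₜ ComplexTorus Φ,
      e OnePoint.infty = 0 ∧ ∀ x : puncturedTorus Φ, e x = (x : ComplexTorus Φ)

end ItemC

/-! ### §4 Sub-node of (a): the unique torsion-free subgroup of index two -/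

section ItemA

/-- **Sub-node (a).1** — "the unique [cf. [Mzk21], Remark 3.1.1] double covering `E → H` by an
Aut-holomorphic space [i.e., the covering determined by the unique torsion-free subgroup of index two of
the group `Π` of Corollary 2.4, (c)]": for the semi-elliptic core `H` (genus `0`, three points of order
`2`, one cusp) the orbifold fundamental group `Π` is the free product of three groups of order two, and
the group-theoretic content of the uniqueness is: the free product `ℤ/2 * ℤ/2 * ℤ/2` has EXACTLY ONE
torsion-free subgroup of index two (the kernel of the homomorphism to `ℤ/2` non-trivial on each factor;
it is free of rank two = `π₁(E^top)`).  "Torsion-free" here = no non-trivial element of finite order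
(stated elementwise); the typed predicate `IsEllipticallyAdmissiblePresentation` uses Mathlib's
`IsMulTorsionFree` (injective `n`-th powers, for non-commutative groups a priori stronger), which free
groups also satisfy.
[cite: MochizukiAbsTopIII2015, Corollary 2.7 (a) p.58] -/
def IndexTwoTorsionFreeUnique : Prop :=
  ∃! P : Subgroup (Monoid.CoprodI fun _ : Fin 3 => Multiplicative (ZMod 2)),
    P.index = 2 ∧ ∀ g ∈ P, IsOfFinOrder g → g = 1

end ItemA

end HolomorphicEllipticCuspidalization

end Literature.AnabelianGeometry.AbsoluteAnabelian

end
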